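import Literature.AlgebraicGeometry.Motives.IntegralModelSpecialFibrePointsOver
import Literature.AlgebraicGeometry.Motives.IntegralModelReductionSurjectiveOnClosedPoints
import Literature.AlgebraicGeometry.Morphisms.EtaleSectionsHenselian
import Literature.RingTheory.Valuation.ValuationSubringHenselian
import Mathlib.AlgebraicGeometry.Morphisms.Etale
import HarnessLib

/-!
# Multiplicity one at an étale point: exactly one point of the generic fibre over `x` reduces to `z`
# ([SerreTate1968] §1; [EGAIV4] Thm. 18.5.17; [StacksProject 04GG (8)]; [Liu2002] §10.1.3)

Topic `Literature/AlgebraicGeometry/Motives`, namespace `Literature.AlgebraicGeometry.Motives.IntegralModel`.  THEOREMS only (no def, no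
instance, no notation, no named fact, no `sorry`).  Cell `hodgecm-mathlib` (D-0151), FLOOR 0, programme F0P5a (D9op road 2′, crux item
stmt-HodgeConjecture-24832), (γ3-GENERIC) row **Γ3-E1** of the desk `F0/P5a/Gamma3-DESK.v0.1.F0P5a-plan-g2.lean` — the decl
`FibreCountOneOfEtaleNear`, VERBATIM (as `ncard_fibre_geomReductionMap_eq_one_of_etale` + the `∀`-form `fibreCountOneOfEtaleNear`):
the MULTIPLICITY-ONE input `_hone` of the two-section pushforward bridge (Γ3-A), in the D1 currency of ★ `IntegralModel.geomReductionMap`.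

DATA (as in ★ p799041 / p799183): a number field `K`, a finite place `v`, PROPER integral models `𝒮`, `𝒯` of `X`, `T` over `𝓞ᵥ`, a model
morphism `π : 𝒯 ⟶ 𝒮` with generic fibre `p : T ⟶ X`; base `R = 𝒪_{\bar K_v}` (`closureValuationSubring`, HENSELIAN ★
`ValuationSubring.henselianLocalRing_of_isAlgClosed`), `ι_κ : Spec κ(R) → Spec R`; an open `U ⊆ 𝒯` on which `π` is ÉTALE.

* §1 `existsUnique_integralPoint_of_etale` — for an `R`-point `x̃` of `𝒮` and a `κ(R)`-point `yκ` of `𝒯` over `ι_κ ≫ x̃` whose underlying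
  point lies in `U`, there is EXACTLY ONE `R`-point `ρ` of `𝒯` with `ρ ≫ π = x̃` and `ι_κ ≫ ρ = yκ` (★ `Morphisms.existsUnique_lift_of_etale`
  at `w := U ↪ 𝒯 → 𝒮`: Hensel existence + unramified-diagonal uniqueness; an `R`-point whose closed point lies in the open `U` factors
  through `U`); `ncard_integralPoints_eq_one_of_etale` the counting form.
* §2 **`ncard_fibre_geomReductionMap_eq_one_of_etale`** — for `x ∈ X(Ω)` and `z ∈ 𝒯ᵥ(κ̄(v))` over `red_𝒮 x` whose point of `𝒯` lies in
  `U`: `#{y ∈ T(Ω) | p y = x, red_𝒯 y = z} = 1` (★ p799183 `ncard_fibre_geomReductionMap_eq_ncard_specialisation` + §1 at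
  `x̃ = extendPoint (e_𝒮⁻¹ x)`, `z = reductionPoint yκ`, ★ p796243 `fst_base_pt_reductionPoint`); `fibreCountOneOfEtaleNear` the desk's
  `∀`-form.

HC_CM is proved only modulo the 7 printed citations until rung 0 closes; this file is a generic leaf and changes no count.

## References
* [SerreTate1968] J.-P. Serre, J. Tate, *Good reduction of abelian varieties*, Ann. of Math. 88 (1968), §1 (the reduction map).
* [EGAIV4] A. Grothendieck, J. Dieudonné, *ÉGA IV₄*, Publ. Math. IHÉS 32 (1967), Thm. 18.5.17 (p. 134) (henselian: sections ↔ rational points of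
  the closed fibre for étale schemes).
* [StacksProject] The Stacks Project, Tag 04GG (8).
* [Liu2002] Q. Liu, *Algebraic Geometry and Arithmetic Curves*, §10.1.3 (reduction of points; Cor. 10.1.38).
-/

set_option autoImplicit false

noncomputable section

open CategoryTheory CategoryTheory.Limits AlgebraicGeometry IsDedekindDomain IsDedekindDomain.HeightOneSpectrum IsLocalRing
open scoped NumberField
open Literature.NumberTheory.EllipticCurves (genericFibre)
open Literature.NumberTheory.GaloisRepresentations (closureValuationSubring)
open Literature.NumberTheory.DiophantineGeometry
open Literature.AlgebraicGeometry.Morphisms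

namespace Literature.AlgebraicGeometry.Motives

namespace IntegralModel

variable {K : Type} [Field K] [NumberField K] {v : HeightOneSpectrum (𝓞 K)} {X T : SchemeOver K}

/-! ### §1 Exactly one integral point over `x̃` with prescribed specialisation through an étale neighbourhood -/

/-- An `R`-point of `𝒯` (`R` local) whose closed point lies in an open `U ⊆ 𝒯` factors through `U` (every point of `Spec R` specialises to
the closed point). [cite: Hartshorne1977, II.4.7] -/
private theorem range_subset_of_closedPoint_mem (𝒯 : IntegralModel (valuationSubringAtPrime K v) K T) (U : (𝒯.total).left.Opens)
    (ρ : specValuationSubring (closureValuationSubring (v.adicCompletion K)) (toClosureValuationSubring v) ⟶ 𝒯.total)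
    (h : ρ.left (closedPoint (closureValuationSubring (v.adicCompletion K))) ∈ U) : Set.range ρ.left ⊆ Set.range U.ι := by
  rintro _ ⟨q, rfl⟩
  rw [Scheme.Opens.range_ι]
  exact ((specializes_closedPoint q).map ρ.left.continuous).mem_open U.2 h

/-- The specialisation `ι_κ ≫ ρ` of an `R`-point reads the closed point: `(ι_κ ≫ ρ)(pt) = ρ(closed point)`. [cite: Hartshorne1977, II.4.7] -/
private theorem specRingHomι_comp_left_apply (𝒯 : IntegralModel (valuationSubringAtPrime K v) K T)
    (ρ : specValuationSubring (closureValuationSubring (v.adicCompletion K)) (toClosureValuationSubring v) ⟶ 𝒯.total) :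
    (specRingHomι (closureValuationSubring (v.adicCompletion K)) (toClosureValuationSubring v)
        (residue (closureValuationSubring (v.adicCompletion K))) ≫ ρ).left
        (closedPoint (ResidueField (closureValuationSubring (v.adicCompletion K)))) =
      ρ.left (closedPoint (closureValuationSubring (v.adicCompletion K))) := by
  rw [Over.comp_left, Scheme.Hom.comp_apply]
  congr 1
  change Spec.map (CommRingCat.ofHom (residue (closureValuationSubring (v.adicCompletion K)))) (closedPoint _) = _
  rw [Spec.map_apply]
  exact comap_closedPoint (residue (closureValuationSubring (v.adicCompletion K)))

/-- **Exactly one integral point with prescribed specialisation through an étale neighbourhood** ([EGAIV4] Thm. 18.5.17 over the henselian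
`R = 𝒪_{\bar K_v}`): for a model morphism `π : 𝒯 ⟶ 𝒮`, an open `U ⊆ 𝒯` with `U ↪ 𝒯 → 𝒮` ÉTALE, an `R`-point `x̃` of `𝒮` and a `κ(R)`-point `yκ`
of `𝒯` over `ι_κ ≫ x̃` whose point lies in `U`, there is exactly one `R`-point `ρ` of `𝒯` over `x̃` with `ι_κ ≫ ρ = yκ`.
[cite: EGAIV4, Thm. 18.5.17 (p. 134)] [cite: StacksProject, Tag 04GG] [cite: SerreTate1968, §1] -/
theorem existsUnique_integralPoint_of_etale (𝒮 : IntegralModel (valuationSubringAtPrime K v) K X)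
    (𝒯 : IntegralModel (valuationSubringAtPrime K v) K T) (π : 𝒯.total ⟶ 𝒮.total)
    (U : (𝒯.total).left.Opens) [Etale (U.ι ≫ π.left)]
    (xt : specValuationSubring (closureValuationSubring (v.adicCompletion K)) (toClosureValuationSubring v) ⟶ 𝒮.total)
    (yκ : residueFieldPoints 𝒯.total)
    (hy : yκ ≫ π = specRingHomι (closureValuationSubring (v.adicCompletion K)) (toClosureValuationSubring v)
        (residue (closureValuationSubring (v.adicCompletion K))) ≫ xt)
    (hyU : yκ.left (closedPoint (ResidueField (closureValuationSubring (v.adicCompletion K)))) ∈ U) :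
    ∃! ρ : specValuationSubring (closureValuationSubring (v.adicCompletion K)) (toClosureValuationSubring v) ⟶ 𝒯.total,
      ρ ≫ π = xt ∧ specRingHomι (closureValuationSubring (v.adicCompletion K)) (toClosureValuationSubring v)
        (residue (closureValuationSubring (v.adicCompletion K))) ≫ ρ = yκ := by
  haveI : HenselianLocalRing (closureValuationSubring (v.adicCompletion K)) :=
    ValuationSubring.henselianLocalRing_of_isAlgClosed (closureValuationSubring (v.adicCompletion K))
  haveI : Subsingleton ↥(Over.left (specRingHomOver (closureValuationSubring (v.adicCompletion K)) (toClosureValuationSubring v)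
      (residue (closureValuationSubring (v.adicCompletion K))))) :=
    inferInstanceAs (Subsingleton (PrimeSpectrum (ResidueField (closureValuationSubring (v.adicCompletion K)))))
  -- `hy` on underlying schemes
  have hy' : yκ.left ≫ π.left = Spec.map (CommRingCat.ofHom (residue (closureValuationSubring (v.adicCompletion K)))) ≫ xt.left := by
    have h : (yκ ≫ π).left = (specRingHomι (closureValuationSubring (v.adicCompletion K)) (toClosureValuationSubring v)
        (residue (closureValuationSubring (v.adicCompletion K))) ≫ xt).left := by rw [hy]
    exact h
  -- the `κ(R)`-point factors through `U`
  have hqU : Set.range yκ.left ⊆ Set.range U.ι := by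
    rintro _ ⟨q, rfl⟩
    obtain rfl : q = closedPoint _ := Subsingleton.elim _ _
    rw [Scheme.Opens.range_ι]
    exact hyU
  obtain ⟨q, hq⟩ : ∃ q : Spec (.of (ResidueField (closureValuationSubring (v.adicCompletion K)))) ⟶ U, q ≫ U.ι = yκ.left :=
    ⟨_, IsOpenImmersion.lift_fac U.ι yκ.left hqU⟩
  have hq' : q ≫ (U.ι ≫ π.left) =
      Spec.map (CommRingCat.ofHom (residue (closureValuationSubring (v.adicCompletion K)))) ≫ xt.left := by
    rw [← Category.assoc, hq]
    exact hy'
  -- the scheme-level statement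
  obtain ⟨σ, ⟨hσ₁, hσ₂⟩, hσu⟩ := existsUnique_lift_of_etale (U.ι ≫ π.left) xt.left q hq'
  have hw : (σ ≫ U.ι) ≫ 𝒯.total.hom =
      (specValuationSubring (closureValuationSubring (v.adicCompletion K)) (toClosureValuationSubring v)).hom := by
    have h1 : π.left ≫ 𝒮.total.hom = 𝒯.total.hom := Over.w π
    have h2 : xt.left ≫ 𝒮.total.hom =
        (specValuationSubring (closureValuationSubring (v.adicCompletion K)) (toClosureValuationSubring v)).hom := Over.w xt
    calc (σ ≫ U.ι) ≫ 𝒯.total.hom = (σ ≫ U.ι) ≫ (π.left ≫ 𝒮.total.hom) := by rw [h1]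
      _ = (σ ≫ U.ι ≫ π.left) ≫ 𝒮.total.hom := by simp only [Category.assoc]
      _ = _ := by rw [hσ₁]; exact h2
  let ρ₀ : specValuationSubring (closureValuationSubring (v.adicCompletion K)) (toClosureValuationSubring v) ⟶ 𝒯.total :=
    Over.homMk (σ ≫ U.ι) hw
  refine ⟨ρ₀, ⟨?_, ?_⟩, fun ρ hρ => ?_⟩
  · ext : 1
    exact (show (σ ≫ U.ι) ≫ π.left = xt.left by simpa only [Category.assoc] using hσ₁)
  · ext : 1
    exact (show Spec.map (CommRingCat.ofHom (residue (closureValuationSubring (v.adicCompletion K)))) ≫ σ ≫ U.ι = yκ.left by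
      rw [← Category.assoc, hσ₂, hq])
  · -- uniqueness: `ρ` factors through `U` and the factorisation is `σ`
    have hρ1 : ρ.left ≫ π.left = xt.left := by
      have h : (ρ ≫ π).left = xt.left := by rw [hρ.1]
      exact h
    have hρ2 : Spec.map (CommRingCat.ofHom (residue (closureValuationSubring (v.adicCompletion K)))) ≫ ρ.left = yκ.left := by
      have h : (specRingHomι (closureValuationSubring (v.adicCompletion K)) (toClosureValuationSubring v)
          (residue (closureValuationSubring (v.adicCompletion K))) ≫ ρ).left = yκ.left := by rw [hρ.2]
      exact h
    have hρU : Set.range ρ.left ⊆ Set.range U.ι := by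
      refine range_subset_of_closedPoint_mem 𝒯 U ρ ?_
      rw [← specRingHomι_comp_left_apply 𝒯 ρ, hρ.2]
      exact hyU
    obtain ⟨σ', hσ'⟩ : ∃ σ' : Spec (.of (closureValuationSubring (v.adicCompletion K))) ⟶ U, σ' ≫ U.ι = ρ.left :=
      ⟨_, IsOpenImmersion.lift_fac U.ι ρ.left hρU⟩
    have h1 : σ' ≫ U.ι ≫ π.left = xt.left := by
      rw [← Category.assoc, hσ']
      exact hρ1
    have h2 : Spec.map (CommRingCat.ofHom (residue (closureValuationSubring (v.adicCompletion K)))) ≫ σ' = q := by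
      rw [← cancel_mono U.ι, Category.assoc, hσ', hρ2, hq]
    have hσ'σ : σ' = σ := hσu σ' ⟨h1, h2⟩
    ext : 1
    exact (show ρ.left = σ ≫ U.ι by rw [← hσ'σ, hσ'])

/-- **Counting form**: under the same hypotheses `#{ρ : Spec R → 𝒯 | ρ ≫ π = x̃, ι_κ ≫ ρ = yκ} = 1`.
[cite: EGAIV4, Thm. 18.5.17 (p. 134)] [cite: SerreTate1968, §1] -/
theorem ncard_integralPoints_eq_one_of_etale (𝒮 : IntegralModel (valuationSubringAtPrime K v) K X)
    (𝒯 : IntegralModel (valuationSubringAtPrime K v) K T) (π : 𝒯.total ⟶ 𝒮.total)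
    (U : (𝒯.total).left.Opens) [Etale (U.ι ≫ π.left)]
    (xt : specValuationSubring (closureValuationSubring (v.adicCompletion K)) (toClosureValuationSubring v) ⟶ 𝒮.total)
    (yκ : residueFieldPoints 𝒯.total)
    (hy : yκ ≫ π = specRingHomι (closureValuationSubring (v.adicCompletion K)) (toClosureValuationSubring v)
        (residue (closureValuationSubring (v.adicCompletion K))) ≫ xt)
    (hyU : yκ.left (closedPoint (ResidueField (closureValuationSubring (v.adicCompletion K)))) ∈ U) :
    Set.ncard {ρ : specValuationSubring (closureValuationSubring (v.adicCompletion K)) (toClosureValuationSubring v) ⟶ 𝒯.total |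
        ρ ≫ π = xt ∧ specRingHomι (closureValuationSubring (v.adicCompletion K)) (toClosureValuationSubring v)
          (residue (closureValuationSubring (v.adicCompletion K))) ≫ ρ = yκ} = 1 := by
  obtain ⟨ρ, hρ, huniq⟩ := existsUnique_integralPoint_of_etale 𝒮 𝒯 π U xt yκ hy hyU
  rw [Set.ncard_eq_one]
  exact ⟨ρ, Set.eq_singleton_iff_unique_mem.2 ⟨hρ, fun ρ' hρ' => huniq ρ' hρ'⟩⟩

/-! ### §2 The desk statement (Γ3-E1): exactly one point of `T(Ω)` over `x` reduces to `z` -/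

/-- **MULTIPLICITY ONE at an étale point of the special fibre** (row Γ3-E1 `FibreCountOneOfEtaleNear` of the F0P5a (γ3-GENERIC) desk):
for PROPER models `𝒮`, `𝒯`, a model morphism `π : 𝒯 ⟶ 𝒮` with generic fibre `p : T ⟶ X`, ÉTALE on an open `U ⊆ 𝒯`, a point `x ∈ X(Ω)` and a
point `z ∈ 𝒯ᵥ(κ̄(v))` over `red_𝒮 x` whose point of `𝒯` lies in `U`, EXACTLY ONE `y ∈ T(Ω)` over `x` reduces to `z`:
`#{y | p y = x, red_𝒯 y = z} = 1`.  (★ `ncard_fibre_geomReductionMap_eq_ncard_specialisation` reduces to §1 at `x̃ = extendPoint (e_𝒮⁻¹ x)`.)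
[cite: SerreTate1968, §1] [cite: EGAIV4, Thm. 18.5.17 (p. 134)] [cite: StacksProject, Tag 04GG] [cite: Liu2002, §10.1.3] -/
theorem ncard_fibre_geomReductionMap_eq_one_of_etale (𝒮 : IntegralModel (valuationSubringAtPrime K v) K X)
    (𝒯 : IntegralModel (valuationSubringAtPrime K v) K T) [IsProper 𝒮.total.hom] [IsProper 𝒯.total.hom]
    (π : 𝒯.total ⟶ 𝒮.total) (p : T ⟶ X)
    (hπp : (genericFibre (valuationSubringAtPrime K v) K).map π ≫ 𝒮.genericIso'.hom = 𝒯.genericIso'.hom ≫ p)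
    (U : (𝒯.total).left.Opens) [Etale (U.ι ≫ π.left)]
    (x : AlgPoints X (AlgebraicClosure (v.adicCompletion K))) (z : AlgPoints 𝒯.reductionAt (geomResidueField v))
    (hz : AlgPoints.map ((specialFibreFunctor v).map π) z = 𝒮.geomReductionMap x)
    (hzU : (z.toSpecHom ≫ pullback.fst 𝒯.total.hom (specResidueField v)).base (closedPoint (geomResidueField v)) ∈ U) :
    Set.ncard {y : AlgPoints T (AlgebraicClosure (v.adicCompletion K)) | AlgPoints.map p y = x ∧ 𝒯.geomReductionMap y = z} = 1 := by
  obtain ⟨yκ, rfl⟩ := 𝒯.reductionPoint_surjective z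
  have hy := (map_reductionPoint_eq_geomReductionMap_iff 𝒮 𝒯 π x yκ).1 hz
  have hyU : yκ.left (closedPoint (ResidueField (closureValuationSubring (v.adicCompletion K)))) ∈ U := by
    have h := IntegralModel.fst_base_pt_reductionPoint 𝒯 yκ
    change yκ.left.base (closedPoint (ResidueField (closureValuationSubring (v.adicCompletion K)))) ∈ U
    rw [← h]
    rw [Scheme.Hom.comp_base, TopCat.comp_app] at hzU
    exact hzU
  rw [ncard_fibre_geomReductionMap_eq_ncard_specialisation 𝒮 𝒯 π p hπp x yκ]
  exact ncard_integralPoints_eq_one_of_etale 𝒮 𝒯 π U _ yκ hy hyU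

/-- **Desk form (Γ3-E1 `FibreCountOneOfEtaleNear`, `F0/P5a/Gamma3-DESK.v0.1` :142), verbatim.**
[cite: SerreTate1968, §1] [cite: EGAIV4, Thm. 18.5.17 (p. 134)] [cite: StacksProject, Tag 04GG] [cite: Liu2002, §10.1.3] -/
theorem fibreCountOneOfEtaleNear :
    ∀ (K : Type) [Field K] [NumberField K] (v : HeightOneSpectrum (𝓞 K)) (X T : SchemeOver K)
      (𝒮 : IntegralModel (valuationSubringAtPrime K v) K X) (𝒯 : IntegralModel (valuationSubringAtPrime K v) K T)
      [IsProper 𝒮.total.hom] [IsProper 𝒯.total.hom] (π : 𝒯.total ⟶ 𝒮.total) (p : T ⟶ X)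
      (_hπp : (genericFibre (valuationSubringAtPrime K v) K).map π ≫ 𝒮.genericIso'.hom = 𝒯.genericIso'.hom ≫ p)
      (U : (𝒯.total).left.Opens) [Etale (U.ι ≫ π.left)]
      (x : AlgPoints X (AlgebraicClosure (v.adicCompletion K))) (z : AlgPoints 𝒯.reductionAt (geomResidueField v))
      (_hz : AlgPoints.map ((specialFibreFunctor v).map π) z = 𝒮.geomReductionMap x)
      (_hzU : (z.toSpecHom ≫ pullback.fst 𝒯.total.hom (specResidueField v)).base (closedPoint (geomResidueField v)) ∈ U),
      Set.ncard {y : AlgPoints T (AlgebraicClosure (v.adicCompletion K)) | AlgPoints.map p y = x ∧ 𝒯.geomReductionMap y = z} = 1 :=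
  fun _ _ _ _ _ _ 𝒮 𝒯 _ _ π p hπp U _ x z hz hzU => ncard_fibre_geomReductionMap_eq_one_of_etale 𝒮 𝒯 π p hπp U x z hz hzU

end IntegralModel

end Literature.AlgebraicGeometry.Motives

end
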